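import Summits.HubbardSuperconductivity.HubbardSuperconductivity.Theorems.AnisotropyChordTransferFibre3GroundSup

/-!
# Route `AnisotropyChord` / H0 rotor rung: the one-loop identity layer FOR THE GROUND PROFILE, smallness hypotheses discharged

Consumer corollaries (rung stmt-HubbardSuperconductivity-19089).  The typed identity/estimate layer (`ProfileFromGreen`,
`DeltaExplicit`, `GreenZeroIdentity`, `TtailBounds`) carries the hypotheses `0 < lam2` and `lam2 < 2·eps1 L` resp. `2·lam2 < eps1 L`
inside the Props; for THE ground profile both are theorems (`lam2_pos`, `two_lam2_lt_eps1`, `lam2_lt_two_eps1`), so the layer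
holds unconditionally for `5 ≤ L`, `0 ≤ Δ < 1`:
* `ground_profile_eq`: `f(r) = 1 + Δf(x̂)/V − c_s·G̃_{λ₂}(r)` off the origin;
* `ground_greenZero`: `G̃_{λ₂}(0) = 1/(Vλ₂) − Δ/(4(1−Δ)+Δλ₂)`; `ground_inv_fnn`: `1/f(x̂) = Δ(1 − 1/V) + (4(1−Δ)+Δλ₂)·G̃_{λ₂}(0)`;
* `ground_deltaExplicit`: `Δ·(4/(Vλ₂) + 1 − 1/V − (4−λ₂)G̃_{λ₂}(0)) = 4/(Vλ₂) − 4G̃_{λ₂}(0)` (the gap equation solved for `Δ`: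
  the Level-2 change of variables `ν ↦ Δ(ν)`);
* `ground_ttail`: the three `TtailBounds` estimates for every `k ≠ 0`.
Prover seat `hubbard-h0-rotor-p1` g24; helper for stmt-HubbardSuperconductivity-19089 (`--supports`).
-/

set_option linter.dupNamespace false
set_option autoImplicit false

noncomputable section

open scoped BigOperators
open Complex

namespace Summit.HubbardSuperconductivity.HubbardSuperconductivity.Theorems.AnisotropyChord.Transfer.Fibre3

variable (L : ℕ) [NeZero L]

/-- ★ the real-space profile of the ground state, unconditionally: `f(r) = 1 + Δf(x̂)/V − c_s G̃_{λ₂}(r)` for `r ≠ 0`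
(`L ≥ 5`, `0 ≤ Δ < 1`). [folklore] -/
theorem ground_profile_eq (hL : 5 ≤ L) {Δ lam2 : ℝ} (hΔ0 : 0 ≤ Δ) (hΔ1 : Δ < 1) {f : Tor L → ℝ}
    (hf : IsGroundTwoMagnon L Δ lam2 f) {r : Tor L} (hr : r ≠ 0) :
    f r = 1 + Δ * f (K1 L) / (L : ℝ) ^ 2 - cS L Δ lam2 f * Gres L lam2 r :=
  profileFromGreen_holds L (by omega) Δ lam2 f hf.1 (lam2_pos L (by omega) hΔ1 hf.1) (lam2_lt_two_eps1 L hL hΔ0 hf) r hr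

/-- ★ the Green-zero identity for the ground state, unconditionally: `G̃_{λ₂}(0) = 1/(Vλ₂) − Δ/(4(1−Δ)+Δλ₂)`. [folklore] -/
theorem ground_greenZero (hL : 5 ≤ L) {Δ lam2 : ℝ} (hΔ0 : 0 ≤ Δ) (hΔ1 : Δ < 1) {f : Tor L → ℝ}
    (hf : IsGroundTwoMagnon L Δ lam2 f) :
    Gres L lam2 0 = 1 / ((L : ℝ) ^ 2 * lam2) - Δ / (4 * (1 - Δ) + Δ * lam2) := by
  have h := greenZeroIdentity_holds L (by omega) Δ lam2 f hf.1 (lam2_pos L (by omega) hΔ1 hf.1)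
    (lam2_lt_two_eps1 L hL hΔ0 hf)
  rwa [← Gres_zero_zero_eq_sum_erase] at h

/-- `G̃_{λ₂}(0) = Gzero λ₂` (names of the two statement files). [folklore] -/
theorem Gres_zero_zero_eq_Gzero (lam2 : ℝ) : Gres L lam2 0 = Gzero L lam2 := gfunZero_holds L lam2

/-- ★ the gap equation solved for `Δ`, for the ground state, unconditionally:
`Δ·(4/(Vλ₂) + 1 − 1/V − (4−λ₂)G̃_{λ₂}(0)) = 4/(Vλ₂) − 4G̃_{λ₂}(0)`. [folklore] -/
theorem ground_deltaExplicit (hL : 5 ≤ L) {Δ lam2 : ℝ} (hΔ0 : 0 ≤ Δ) (hΔ1 : Δ < 1) {f : Tor L → ℝ}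
    (hf : IsGroundTwoMagnon L Δ lam2 f) :
    Δ * (4 / ((L : ℝ) ^ 2 * lam2) + 1 - 1 / (L : ℝ) ^ 2 - (4 - lam2) * Gres L lam2 0)
      = 4 / ((L : ℝ) ^ 2 * lam2) - 4 * Gres L lam2 0 := by
  rw [Gres_zero_zero_eq_Gzero]
  exact deltaExplicit_holds L (by omega) Δ lam2 f hf.1 (lam2_pos L (by omega) hΔ1 hf.1) (lam2_lt_two_eps1 L hL hΔ0 hf)

/-- ★ the contact value through the Green's function: `1/f(x̂) = Δ(1 − 1/V) + (4(1−Δ)+Δλ₂)·G̃_{λ₂}(0)`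
(`L ≥ 5`, `0 ≤ Δ < 1`). [folklore] -/
theorem ground_inv_fnn (hL : 5 ≤ L) {Δ lam2 : ℝ} (hΔ0 : 0 ≤ Δ) (hΔ1 : Δ < 1) {f : Tor L → ℝ}
    (hf : IsGroundTwoMagnon L Δ lam2 f) :
    1 / f (K1 L) = Δ * (1 - 1 / (L : ℝ) ^ 2) + (4 * (1 - Δ) + Δ * lam2) * Gres L lam2 0 := by
  have hfnn : 0 < f (K1 L) := hf.1.2.2.1
  have hc := cS_mul_Gres_zero L hL hΔ0 hΔ1 hf
  unfold cS at hc
  have hV : (0 : ℝ) < (L : ℝ) ^ 2 := by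
    have : (0 : ℝ) < L := by exact_mod_cast (show 0 < L by omega)
    positivity
  have e : (4 * (1 - Δ) + Δ * lam2) * Gres L lam2 0 = (1 + Δ * f (K1 L) / (L : ℝ) ^ 2 - Δ * f (K1 L)) / f (K1 L) := by
    rw [eq_div_iff hfnn.ne']
    linarith
  rw [e]
  field_simp
  ring

/-- ★ the `TtailBounds` estimates for the ground state, unconditionally (`L ≥ 5`, `0 ≤ Δ < 1`, `k ≠ 0`). [folklore] -/
theorem ground_ttail (hL : 5 ≤ L) {Δ lam2 : ℝ} (hΔ0 : 0 ≤ Δ) (hΔ1 : Δ < 1) {f : Tor L → ℝ}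
    (hf : IsGroundTwoMagnon L Δ lam2 f) {k : Tor L} (hk : k ≠ 0) :
    -(2 * Δ * f (K1 L) * cS L Δ lam2 f / (2 * epsT L k - lam2)) / (L : ℝ) ^ 2 ≤ tfun L Δ f k ∧
    tfun L Δ f k ≤ ∑ r : Tor L, sfun' L Δ f r ^ 2 ∧
    tfun L Δ f k ≤ 2 * cS L Δ lam2 f ^ 2 * Gzero L lam2 / (epsT L k - 2 * lam2) :=
  ttailBounds_holds L (by omega) hΔ0 lam2 f hf (lam2_pos L (by omega) hΔ1 hf.1) (two_lam2_lt_eps1 L hL hΔ0 hf) k hk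

end Summit.HubbardSuperconductivity.HubbardSuperconductivity.Theorems.AnisotropyChord.Transfer.Fibre3

end
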